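/-
Copyright (c) 2026 the pub-hodgecm-mathlib formalisation cell (harness21).  Prover seat hodgecm-mathlib-LH10-p01 (g13): road M6 → F5 → dyadic chain of `stub_DyUnramCore` (D-UNR),
site (L2-3) «THE WALL» ∕ (P-2) ROW-0, row 5 «ORDER-CM-θ» of CENSUS-L23-CM v1 (LH10-p01 (g12)) — the θ-twin of ★ γ₄ `shifted_order_memberships`; 2026-09-03.
-/
import Literature.NumberTheory.Rogawski1990.TypeTwoCayleyShiftOrderCM       -- ★ γ₄ (F0P2-p06 (g10)): `mem_integer_iff_valued_le_one`, `smul_units_conj_add_smul_one`, `units_conj_nonsing_inv`; brings ★ γ₃ (`map_smul_add_smul_one`, `smul_reindex_add_smul_one`, `smul_fromBlocks_add_smul_one`, `isUnit_localRing_of_ne_zero_of_subsingleton`), γ₂, γ₁, `conjLocal_apply_eq_of_smul_eq`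
import Literature.NumberTheory.Automorphic.MatrixHermitianMoebiusShiftOrder    -- ★ P4 p853652 (LH10-p01 (g12)): `hermitianMoebius_mem_adjoin`, `hermitianMoebius_inv_mem_adjoin`, `mem_adjoin_hermitianMoebius` (the 2-free shifted order)
import Literature.NumberTheory.Automorphic.TypeTwoHermitianMoebiusShiftFrame   -- ★ P3 p853657 (LH10-p01 (g12)): `hermitianMoebius_one_add_smul_eq`, `valued_map_eq_one_of_add_map_eq_one`; brings ★ P2 `smul_one_add_smul_add_smul_one_of_add_eq`
import Literature.NumberTheory.Rogawski1990.TypeTwoHermitianShiftCM          -- ★ p853677 (LH4-p01 (g12)): the θ-carriers; brings ★ P1 `moebius_conj'` and ★ p853671 `map_genMoebius`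
import HarnessLib

/-!
# The HERMITIAN-shifted order at a CM place, type (2), 2-FREE: `φ_θ(δ)_w, φ_θ(δ)_w⁻¹ ∈ 𝒪_w[1 + c_w⁻¹(δ_w − 1)]` and `1 + c_w⁻¹(δ_w − 1) ∈ 𝒪_w[φ_θ(δ)_w]`

Topic `NumberTheory/Rogawski1990`; namespace `Literature.NumberTheory.Rogawski1990`.  THEOREMS ONLY (no definition, no instance, no notation, no named fact, no `sorry`); kernel lane
`--supports stmt-HodgeConjecture-24833`.  Cell `pub/hodgecm-mathlib` (D-0151), crux H413 = `stmt-HodgeConjecture-24833`; road M6 → F5 → the dyadic chain of organ (D-UNR)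
`stub_DyUnramCore`, LEVEL TWO ∕ (P-2) ROW-0.  Row 5 of CENSUS-L23-CM v1 (LH10-p01 (g12)): ★ γ₄ `shifted_order_memberships … h2 …` = the hypotheses `hY hY′ hX` of ★ ROW-0 = #FIX(Y)
(`DepthZeroKappaTransferTypeTwoRowZero` :133) for the σ-FIXED Cayley shift `φ_c` of a match of a (level-1) deep type-(2) `γ_H`, whose denominators `2·1 + (c ± 1)W` and order identity
(★ α `mem_adjoin_moebius (h2 : 2 unit)`) need `|2|_w = 1`.  THIS FILE is the θ-twin for the HERMITIAN shift `φ_θ(M) = (θ•M + (c−θ)•1)((c−θ′)•M + θ′•1)⁻¹`, `θ′ = σθ`, `θ + θ′ = 1`,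
`θ` integral, at ANY residue characteristic (★ N2′'s 2-deep twin is ★ `HermitianShiftOrderDeepCM`, this seat).

THE MATHEMATICS (★ γ₄'s proof with the θ-heads of ★ P3∕P4 substituted).  `ι(γ_H)_w = 1 + c_w·W`, `W = c_w⁻¹(ι(γ_H)_w − 1) = reindex endoPerm (X₂ ⊕ y)` entrywise integral (deepness
in `c_w`; `X₂ = c_w⁻¹(g_w − 1)`, `y = c_w⁻¹(u_w − 1)`), so `N₊ = 1 + θ_w W`, `N₋ = 1 + (c_w − θ′_w)W` have determinants `det(1 + θ_w X₂)(1 + θ_w y)`, `det(1 + (c_w − θ′_w)X₂)(1 + (c_w − θ′_w)y)`,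
which are UNITS because `θ•g + (c−θ)•1 = c•(1 + θX₂)`, `(c−θ′)•g + θ′•1 = c•(1 + (c−θ′)X₂)` (★ P2 `smul_one_add_smul_add_smul_one_of_add_eq`) and the four denominators have
`w`-valuations `exp(−2), exp(−2), exp(−1), exp(−1)`.  BINDERS: as in ★ `TypeTwoHermitianShiftIntegralCM` (this seat), those four valuations are TAKEN (`hw2m hw2p hw1m hw1p` =
conjuncts 1–4 of «BINDERS-θ TYPE (2)» `isUnit_hermitianShift_denominators_of_typeTwo`, LH7-p04 (g13)) instead of re-derived from the discriminant depth through ★ γ₃.  ★ P3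
`hermitianMoebius_one_add_smul_eq`: `φ_θ(ι(γ_H)_w) = N₊N₋⁻¹ =: Y₀`; ★ P4: `Y₀, Y₀⁻¹ ∈ 𝒪_w[W]` and `W ∈ 𝒪_w[Y₀]` (side units `1 − c_w`, `c_w − θ′_w` by ★ P3 §6
`valued_map_eq_one_of_add_map_eq_one`).  A match `δ` is `x·ι(γ_H)·x⁻¹` in `GL₃(E_v)`: `φ_θ(δ)_w = x_w Y₀ x_w⁻¹` (★ p853671 `map_genMoebius`, ★ P1 `moebius_conj'`),
`1 + c_w⁻¹(δ_w − 1) = x_w(1 + W)x_w⁻¹`, and conjugation transports the memberships (★ γ₂ `conj_mem_adjoin_of_mem_adjoin`).  The integers are the `ValuativeRel` integers `𝒪[L_w]`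
of ★ ROW-0 (bridge ★ γ₄ `mem_integer_iff_valued_le_one`).  Count-neutral CM glue; nothing printed is asserted.
HONEST LABEL: L2-3 remains THE WALL at the CM-glue layer until every row of CENSUS-L23-CM is paid and `stub_liftInterior_dy` lands; HC_CM is proved only modulo the 7 printed
citations (2 remaining: hLiu418 = stmt-HodgeConjecture-24832, h413 = stmt-HodgeConjecture-24833) until rung 0 closes.

## References
* [Kottwitz1986BaseChangeUnits] R. E. Kottwitz, *Base change for unit elements of Hecke algebras*, Compositio Math. 60 (1986): §2 pp. 244–247.
* [Rogawski1990] J. D. Rogawski, *Automorphic Representations of Unitary Groups in Three Variables*, Ann. of Math. Stud. 123 (1990): §4.9 Prop. 4.9.1 (b) p. 55.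
* [Serre1980Trees] J.-P. Serre, *Trees* (1980): Ch. II §1.1–1.2.
-/

set_option autoImplicit false

noncomputable section

open NumberField IsDedekindDomain Matrix Polynomial
open scoped MatrixGroups WithZero ValuativeRel

namespace Literature.NumberTheory.Rogawski1990

open Literature.NumberTheory.Automorphic Literature.NumberTheory.Automorphic.UnitaryGroup Literature.NumberTheory.Automorphic.MoebiusShift
open Literature.NumberTheory.GaloisRepresentations Literature.NumberTheory.NumberFields

variable (L : Type) [Field L] [NumberField L] [IsCMField L] (v : HeightOneSpectrum (𝓞 ↥(maximalRealSubfield L)))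
  (w : PlacesOver L v) (hw : IsCMField.complexConj L • w.1 = w.1)

include hw in
set_option maxHeartbeats 1600000 in
-- the carriers' types are large (same budget as ★ γ₄)
/-- **«ORDER-CM-θ» — THE HERMITIAN-SHIFTED ORDER MEMBERSHIPS, TYPE (2), 2-FREE** (`hY hY′ hX` of ★ ROW-0 = #FIX(Y) for `φ_θ`; θ-twin of ★ γ₄ `shifted_order_memberships`): at a non-split
place (`σ • w = w`), for `|c_w| = exp(−1)`, `θ′ = σθ` (`σ = c ⊗ 1` on `E_v`), `θ + θ′ = 1`, `|θ_w| ≤ 1`, a deep type-(2) `γ_H = (g, u)` (`g_w ≡ 1`, `u_w ≡ 1 (mod c_w)` entrywise)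
whose denominators have `w`-valuations `|det((c−θ′)•g + θ′•1)|_w = |det(θ•g + (c−θ)•1)|_w = exp(−2)`, `|(c−θ′)u + θ′|_w = |θu + (c−θ)|_w = exp(−1)` (conjuncts 1–4 of
«BINDERS-θ TYPE (2)»), a match `δ` of `γ_H` and `δ′` with matrix `φ_θ(δ) = (θ•δ + (c−θ)•1)((c−θ′)•δ + θ′•1)⁻¹`: with `Y := (δ′)_w`, `X_δ := 1 + c_w⁻¹((δ)_w − 1)`,
`Y ∈ 𝒪_w[X_δ]`, `Y⁻¹ ∈ 𝒪_w[X_δ]`, `X_δ ∈ 𝒪_w[Y]`.  No `|2|_w = 1`.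
[cite: Kottwitz1986BaseChangeUnits, §2 pp. 244–247] [cite: Rogawski1990, §4.9 Prop. 4.9.1 (b) p. 55] [cite: Serre1980Trees, Ch. II §1.1–1.2] -/
theorem hermitianShifted_order_memberships (H' : Matrix (Fin 3) (Fin 3) L)
    (γH : (cmDatum L 2 (Matrix.of fun i j : Fin 2 => if i.val + j.val + 1 = 2 then (1 : L) else 0)).Local v ×
      (cmDatum L 1 (Matrix.of fun i j : Fin 1 => if i.val + j.val + 1 = 1 then (1 : L) else 0)).Local v)
    (δ δ' : (cmDatum L 3 H').Local v)
    {c θ θ' : LocalRing L v} (hc : Valued.v (c w) = WithZero.exp (-1 : ℤ))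
    (hθθ' : conjLocal L (IsCMField.complexConj L) v θ = θ') (hθ : θ + θ' = 1) (hθv : Valued.v (θ w) ≤ 1)
    (hg1 : ∀ i j, Valued.v ((((γH.1.val : GL (Fin 2) (LocalRing L v)).val.map (Pi.evalRingHom (fun w' : PlacesOver L v => w'.1.adicCompletion L) w)) - 1) i j) ≤ Valued.v (c w))
    (hu1 : Valued.v (finGammaTwo L v γH w - 1) ≤ Valued.v (c w))
    (hw2m : Valued.v ((((c - θ') • ((γH.1.val : GL (Fin 2) (LocalRing L v)).val : Matrix (Fin 2) (Fin 2) (LocalRing L v)) + θ' • (1 : Matrix (Fin 2) (Fin 2) (LocalRing L v))).det) w) =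
      WithZero.exp (-2 : ℤ))
    (hw2p : Valued.v (((θ • ((γH.1.val : GL (Fin 2) (LocalRing L v)).val : Matrix (Fin 2) (Fin 2) (LocalRing L v)) + (c - θ) • (1 : Matrix (Fin 2) (Fin 2) (LocalRing L v))).det) w) =
      WithZero.exp (-2 : ℤ))
    (hw1m : Valued.v (((c - θ') * finGammaTwo L v γH + θ') w) = WithZero.exp (-1 : ℤ))
    (hw1p : Valued.v ((θ * finGammaTwo L v γH + (c - θ)) w) = WithZero.exp (-1 : ℤ))
    (h : IsLocalNormPair L H' v γH δ)
    (hδ : ((δ'.val : GL (Fin 3) (LocalRing L v)).val : Matrix (Fin 3) (Fin 3) (LocalRing L v)) =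
      (θ • ((δ.val : GL (Fin 3) (LocalRing L v)).val : Matrix (Fin 3) (Fin 3) (LocalRing L v)) + (c - θ) • 1) *
        ((c - θ') • ((δ.val : GL (Fin 3) (LocalRing L v)).val : Matrix (Fin 3) (Fin 3) (LocalRing L v)) + θ' • 1)⁻¹) :
    ((δ'.val : GL (Fin 3) (LocalRing L v)).val.map (Pi.evalRingHom (fun w' : PlacesOver L v => w'.1.adicCompletion L) w)) ∈
        Algebra.adjoin 𝒪[w.1.adicCompletion L] ({1 + (c w)⁻¹ • (((δ.val : GL (Fin 3) (LocalRing L v)).val.map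
          (Pi.evalRingHom (fun w' : PlacesOver L v => w'.1.adicCompletion L) w)) - 1)} : Set (Matrix (Fin 3) (Fin 3) (w.1.adicCompletion L))) ∧
      ((δ'.val : GL (Fin 3) (LocalRing L v)).val.map (Pi.evalRingHom (fun w' : PlacesOver L v => w'.1.adicCompletion L) w))⁻¹ ∈
        Algebra.adjoin 𝒪[w.1.adicCompletion L] ({1 + (c w)⁻¹ • (((δ.val : GL (Fin 3) (LocalRing L v)).val.map
          (Pi.evalRingHom (fun w' : PlacesOver L v => w'.1.adicCompletion L) w)) - 1)} : Set (Matrix (Fin 3) (Fin 3) (w.1.adicCompletion L))) ∧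
      (1 + (c w)⁻¹ • (((δ.val : GL (Fin 3) (LocalRing L v)).val.map (Pi.evalRingHom (fun w' : PlacesOver L v => w'.1.adicCompletion L) w)) - 1)) ∈
        Algebra.adjoin 𝒪[w.1.adicCompletion L] ({((δ'.val : GL (Fin 3) (LocalRing L v)).val.map
          (Pi.evalRingHom (fun w' : PlacesOver L v => w'.1.adicCompletion L) w))} : Set (Matrix (Fin 3) (Fin 3) (w.1.adicCompletion L))) := by
  have hv : Subsingleton (PlacesOver L v) := PlacesOver.subsingleton_of_smul_eq (IsCMField.complexConj L) (IsCMField.complexConj_ne_one L) w hw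
  set evw : LocalRing L v →+* w.1.adicCompletion L := Pi.evalRingHom (fun w' : PlacesOver L v => w'.1.adicCompletion L) w with hevw
  set O : Subring (w.1.adicCompletion L) := 𝒪[w.1.adicCompletion L] with hOdef
  have hO : ∀ {z : w.1.adicCompletion L}, z ∈ O ↔ Valued.v z ≤ 1 := fun {z} => mem_integer_iff_valued_le_one L v w z
  set σw := galAdicCompletionMap (L := L) (IsCMField.complexConj L) hw with hσw
  have hσ : ∀ x, Valued.v (σw x) = Valued.v x := fun x => valued_galAdicCompletionMap (L := L) (IsCMField.complexConj L) hw x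
  set gw : Matrix (Fin 2) (Fin 2) (w.1.adicCompletion L) := ((γH.1.val : GL (Fin 2) (LocalRing L v)).val.map evw) with hgw
  set Uw : Matrix (Fin 1) (Fin 1) (w.1.adicCompletion L) := ((γH.2.val : GL (Fin 1) (LocalRing L v)).val.map evw) with hUw
  set uw : w.1.adicCompletion L := finGammaTwo L v γH w with huw
  set cw : w.1.adicCompletion L := c w with hcw
  set θw : w.1.adicCompletion L := θ w with hθwdef
  set θ'w : w.1.adicCompletion L := θ' w with hθ'wdef
  set ιw : Matrix (Fin 3) (Fin 3) (w.1.adicCompletion L) := (((endoEmbLocal L v γH).val : GL (Fin 3) (LocalRing L v)).val.map evw) with hιw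
  set δw : Matrix (Fin 3) (Fin 3) (w.1.adicCompletion L) := ((δ.val : GL (Fin 3) (LocalRing L v)).val.map evw) with hδw
  obtain ⟨hc0, hc1, -, -, -, -⟩ := shift_parameter_facts hc
  have hUw00 : Uw 0 0 = uw := rfl
  -- the scalars at `w`: `θ_w + θ′_w = 1`, `θ′_w = σ_w θ_w`, `|θ′_w| = 1`, `|c_w − θ′_w| = 1`, `|1 − c_w| = 1`
  have hθw : θw + θ'w = 1 := congrFun hθ w
  have hσθ : σw θw = θ'w := by
    have h' := congrFun hθθ' w
    rw [conjLocal_apply_eq_of_smul_eq (IsCMField.complexConj L) (IsCMField.complexConj_ne_one L) v w hw] at h'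
    exact h'
  have hθσ : θw + σw θw = 1 := by rw [hσθ]; exact hθw
  obtain ⟨hθ'1, -, hct1⟩ := valued_map_eq_one_of_add_map_eq_one σw hσ hθv hθσ
  have hθ'v : Valued.v θ'w ≤ 1 := by rw [← hσθ]; exact hθ'1.le
  have hct : Valued.v (cw - θ'w) = 1 := by rw [← hσθ]; exact hct1 hc1
  have h1c : Valued.v (1 - cw) = 1 := Valuation.map_one_sub_of_lt _ hc1
  -- `ι_w = reindex endoPerm (g_w ⊕ U_w)` and `W = c_w⁻¹(ι_w − 1) = reindex endoPerm (X₂ ⊕ Y₁)` (★ γ₄ verbatim)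
  have hι : ιw = Matrix.reindex endoPerm endoPerm (Matrix.fromBlocks gw 0 0 Uw) := by
    rw [hιw, coe_endoEmbLocal, coe_endoGL, Matrix.reindex_apply, ← Matrix.submatrix_map, Matrix.fromBlocks_map]
    simp [Matrix.reindex_apply, gw, Uw]
  set X₂ : Matrix (Fin 2) (Fin 2) (w.1.adicCompletion L) := cw⁻¹ • (gw - 1) with hX₂
  set Y₁ : Matrix (Fin 1) (Fin 1) (w.1.adicCompletion L) := cw⁻¹ • (Uw - 1) with hY₁
  set W : Matrix (Fin 3) (Fin 3) (w.1.adicCompletion L) := cw⁻¹ • (ιw - 1) with hW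
  have hιW : ιw = 1 + cw • W := eq_one_add_smul_inv_smul_sub_one hc0 ιw
  have hWb : W = Matrix.reindex endoPerm endoPerm (Matrix.fromBlocks X₂ 0 0 Y₁) := by
    have e1 : ιw - 1 = Matrix.reindex endoPerm endoPerm (Matrix.fromBlocks (gw - 1) 0 0 (Uw - 1)) := by
      have h := smul_reindex_add_smul_one (R := w.1.adicCompletion L) endoPerm (Matrix.fromBlocks gw 0 0 Uw) 1 (-1)
      rw [smul_fromBlocks_add_smul_one, one_smul, one_smul, one_smul, neg_one_smul, neg_one_smul, neg_one_smul, ← sub_eq_add_neg, ← sub_eq_add_neg, ← sub_eq_add_neg, ← hι] at h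
      exact h
    rw [hW, e1, hX₂, hY₁, Matrix.reindex_apply, Matrix.reindex_apply]
    have e2 : Matrix.fromBlocks (cw⁻¹ • (gw - 1)) 0 0 (cw⁻¹ • (Uw - 1)) = cw⁻¹ • Matrix.fromBlocks (gw - 1) 0 0 (Uw - 1) := by
      rw [Matrix.fromBlocks_smul, smul_zero, smul_zero]
    rw [e2]
    rfl
  -- entrywise integrality of `W` (deepness in `c_w`)
  have hX₂i : ∀ i j, Valued.v (X₂ i j) ≤ 1 := forall_valued_inv_smul_sub_one_le_one hc0 hg1
  have hY₁i : ∀ i j, Valued.v (Y₁ i j) ≤ 1 := fun i j => by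
    obtain rfl : i = 0 := Subsingleton.elim _ _
    obtain rfl : j = 0 := Subsingleton.elim _ _
    rw [hY₁, Matrix.smul_apply, Matrix.sub_apply, Matrix.one_apply_eq, hUw00, smul_eq_mul]
    exact valued_inv_mul_sub_one_le_one hc0 hu1
  have hWi : ∀ i j, Valued.v (W i j) ≤ 1 := by
    intro i j
    rw [hWb, Matrix.reindex_apply, Matrix.submatrix_apply]
    rcases endoPerm.symm i with a | a <;> rcases endoPerm.symm j with b | b
    · rw [Matrix.fromBlocks_apply₁₁]; exact hX₂i a b
    · rw [Matrix.fromBlocks_apply₁₂, Matrix.zero_apply, map_zero]; exact zero_le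
    · rw [Matrix.fromBlocks_apply₂₁, Matrix.zero_apply, map_zero]; exact zero_le
    · rw [Matrix.fromBlocks_apply₂₂]; exact hY₁i a b
  have hWO : ∀ i j, W i j ∈ O := fun i j => hO.2 (hWi i j)
  have hcO : cw ∈ O := hO.2 hc1.le
  have hθO : θw ∈ O := hO.2 hθv
  have hθ'O : θ'w ∈ O := hO.2 hθ'v
  have htO : cw - θ'w ∈ O := hO.2 hct.le
  -- the determinants of `N± = 1 + tW` (`t = c_w − θ′_w`, `θ_w`) factor through the blocks: `det(1 + tX₂)·(1 + t y)`
  have hgX : gw = 1 + cw • X₂ := eq_one_add_smul_inv_smul_sub_one hc0 gw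
  have huy : uw = 1 + cw * (cw⁻¹ * (uw - 1)) := by rw [← mul_assoc, mul_inv_cancel₀ hc0, one_mul, add_sub_cancel]
  have hdet2w : ∀ a b : LocalRing L v, ((a • ((γH.1.val : GL (Fin 2) (LocalRing L v)).val : Matrix (Fin 2) (Fin 2) (LocalRing L v)) + b • (1 : Matrix (Fin 2) (Fin 2) (LocalRing L v))).det) w =
      (a w • gw + b w • (1 : Matrix (Fin 2) (Fin 2) (w.1.adicCompletion L))).det := fun a b => by
    have e1 : ((a • ((γH.1.val : GL (Fin 2) (LocalRing L v)).val : Matrix (Fin 2) (Fin 2) (LocalRing L v)) + b • (1 : Matrix (Fin 2) (Fin 2) (LocalRing L v))).det) w =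
        evw ((a • ((γH.1.val : GL (Fin 2) (LocalRing L v)).val : Matrix (Fin 2) (Fin 2) (LocalRing L v)) + b • (1 : Matrix (Fin 2) (Fin 2) (LocalRing L v))).det) := rfl
    rw [e1, RingHom.map_det, RingHom.mapMatrix_apply, map_smul_add_smul_one]
    rfl
  have hNdet : ∀ t : w.1.adicCompletion L, ((1 : w.1.adicCompletion L) • (1 : Matrix (Fin 3) (Fin 3) (w.1.adicCompletion L)) + t • W).det =
      ((1 : w.1.adicCompletion L) • (1 : Matrix (Fin 2) (Fin 2) (w.1.adicCompletion L)) + t • X₂).det * (1 + t * (cw⁻¹ * (uw - 1))) := fun t => by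
    rw [hWb, add_comm, smul_reindex_add_smul_one, smul_fromBlocks_add_smul_one, Matrix.det_reindex_self, Matrix.det_fromBlocks_zero₁₂, add_comm (t • X₂), Matrix.det_fin_one]
    congr 1
    rw [Matrix.add_apply, Matrix.smul_apply, Matrix.smul_apply, Matrix.one_apply_eq, hY₁, Matrix.smul_apply, Matrix.sub_apply, Matrix.one_apply_eq, hUw00]
    simp only [smul_eq_mul, mul_one]
    ring
  -- the four cofactors are units, read off `hw2m hw2p hw1m hw1p` (★ P2 `smul_one_add_smul_add_smul_one_of_add_eq`)
  have hval : ∀ {z : w.1.adicCompletion L} {k : ℕ}, Valued.v (cw ^ k * z) = WithZero.exp (-(k : ℤ)) → Valued.v z = 1 := fun {z k} hz => by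
    rw [map_mul, map_pow, hc, ← WithZero.exp_nsmul] at hz
    have hne' : WithZero.exp (k • (-1 : ℤ)) ≠ 0 := WithZero.exp_ne_zero
    have h' := (eq_inv_mul_iff_mul_eq₀ hne').2 hz
    rw [h', ← WithZero.exp_neg, ← WithZero.exp_add, ← WithZero.exp_zero, WithZero.exp_inj]
    simp
  have hvm2 : Valued.v (((1 : Matrix (Fin 2) (Fin 2) (w.1.adicCompletion L)) + (cw - θ'w) • X₂).det) = 1 := by
    have e := hdet2w (c - θ') θ'
    rw [show (c - θ') w = cw - θ'w from rfl, show θ' w = θ'w from rfl, hgX, smul_one_add_smul_add_smul_one_of_add_eq X₂ cw (cw - θ'w) θ'w (by ring),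
      Matrix.det_smul, Fintype.card_fin] at e
    have h := hw2m
    rw [e] at h
    exact hval h
  have hvp2 : Valued.v (((1 : Matrix (Fin 2) (Fin 2) (w.1.adicCompletion L)) + θw • X₂).det) = 1 := by
    have e := hdet2w θ (c - θ)
    rw [show (c - θ) w = cw - θw from rfl, show θ w = θw from rfl, hgX, smul_one_add_smul_add_smul_one_of_add_eq X₂ cw θw (cw - θw) (by ring),
      Matrix.det_smul, Fintype.card_fin] at e
    have h := hw2p
    rw [e] at h
    exact hval h
  have hvm1 : Valued.v (1 + (cw - θ'w) * (cw⁻¹ * (uw - 1))) = 1 := by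
    have e : ((c - θ') * finGammaTwo L v γH + θ') w = cw ^ 1 * (1 + (cw - θ'w) * (cw⁻¹ * (uw - 1))) := by
      have e0 : ((c - θ') * finGammaTwo L v γH + θ') w = (cw - θ'w) * uw + θ'w := rfl
      rw [e0]; nth_rewrite 1 [huy]; ring
    have h := hw1m
    rw [e] at h
    exact hval h
  have hvp1 : Valued.v (1 + θw * (cw⁻¹ * (uw - 1))) = 1 := by
    have e : (θ * finGammaTwo L v γH + (c - θ)) w = cw ^ 1 * (1 + θw * (cw⁻¹ * (uw - 1))) := by
      have e0 : (θ * finGammaTwo L v γH + (c - θ)) w = θw * uw + (cw - θw) := rfl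
      rw [e0]; nth_rewrite 1 [huy]; ring
    have h := hw1p
    rw [e] at h
    exact hval h
  have hunit : ∀ {z : w.1.adicCompletion L}, Valued.v z = 1 → ∃ d ∈ O, d * z = 1 := fun {z} hz => by
    have hz0 : z ≠ 0 := fun h0 => by rw [h0, map_zero] at hz; exact zero_ne_one hz
    exact ⟨z⁻¹, hO.2 (by rw [map_inv₀, hz, inv_one]), inv_mul_cancel₀ hz0⟩
  have hm : ∃ d ∈ O, d * ((1 : w.1.adicCompletion L) • (1 : Matrix (Fin 3) (Fin 3) (w.1.adicCompletion L)) + (cw - θ'w) • W).det = 1 :=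
    hunit (by rw [hNdet, map_mul, one_smul, hvm2, hvm1, one_mul])
  have hp : ∃ d ∈ O, d * ((1 : w.1.adicCompletion L) • (1 : Matrix (Fin 3) (Fin 3) (w.1.adicCompletion L)) + θw • W).det = 1 :=
    hunit (by rw [hNdet, map_mul, one_smul, hvp2, hvp1, one_mul])
  have h1cO : ∃ e ∈ O, e * (1 - cw) = 1 := hunit h1c
  have hctO : ∃ e ∈ O, e * (cw - θ'w) = 1 := hunit hct
  -- ★ P4: the 2-free order identities for `W`
  set Y₀ : Matrix (Fin 3) (Fin 3) (w.1.adicCompletion L) := ((1 : w.1.adicCompletion L) • (1 : Matrix (Fin 3) (Fin 3) (w.1.adicCompletion L)) + θw • W) *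
    ((1 : w.1.adicCompletion L) • (1 : Matrix (Fin 3) (Fin 3) (w.1.adicCompletion L)) + (cw - θ'w) • W)⁻¹ with hY₀
  have hY₀mem : Y₀ ∈ Algebra.adjoin O ({W} : Set (Matrix (Fin 3) (Fin 3) (w.1.adicCompletion L))) := hermitianMoebius_mem_adjoin O hWO hθO htO hm
  have hY₀inv : Y₀⁻¹ ∈ Algebra.adjoin O ({W} : Set (Matrix (Fin 3) (Fin 3) (w.1.adicCompletion L))) := hermitianMoebius_inv_mem_adjoin O hWO hθO htO hm hp
  have hWmem : W ∈ Algebra.adjoin O ({Y₀} : Set (Matrix (Fin 3) (Fin 3) (w.1.adicCompletion L))) := mem_adjoin_hermitianMoebius O hWO hθO hθ'O hcO hθw h1cO hctO hm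
  -- the match: `δ_w = x_w ι_w x_w⁻¹`
  obtain ⟨x, hx⟩ := isConj_iff.1 h
  have hxdet : IsUnit (((x : GL (Fin 3) (LocalRing L v)) : Matrix (Fin 3) (Fin 3) (LocalRing L v)).map evw).det := by
    rw [← RingHom.mapMatrix_apply, ← RingHom.map_det]; exact (Matrix.isUnits_det_units x).map _
  set P : GL (Fin 3) (w.1.adicCompletion L) := Matrix.nonsingInvUnit _ hxdet with hP
  have hPv : (P : Matrix (Fin 3) (Fin 3) (w.1.adicCompletion L)) = ((x : GL (Fin 3) (LocalRing L v)) : Matrix (Fin 3) (Fin 3) (LocalRing L v)).map evw := rfl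
  have hPi : ((P⁻¹ : GL (Fin 3) (w.1.adicCompletion L)) : Matrix (Fin 3) (Fin 3) (w.1.adicCompletion L)) = (((x : GL (Fin 3) (LocalRing L v)) : Matrix (Fin 3) (Fin 3) (LocalRing L v)).map evw)⁻¹ := by
    rw [Matrix.coe_units_inv, hPv]
  have hmx : ((δ.val : GL (Fin 3) (LocalRing L v)).val : Matrix (Fin 3) (Fin 3) (LocalRing L v)) =
      (x : GL (Fin 3) (LocalRing L v)).val * (((endoEmbLocal L v γH).val : GL (Fin 3) (LocalRing L v)).val) * (x⁻¹ : GL (Fin 3) (LocalRing L v)).val := by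
    rw [← hx, Units.val_mul, Units.val_mul]; rfl
  have hδconj : δw = (P : Matrix (Fin 3) (Fin 3) (w.1.adicCompletion L)) * ιw * ((P⁻¹ : GL (Fin 3) (w.1.adicCompletion L)) : Matrix (Fin 3) (Fin 3) (w.1.adicCompletion L)) := by
    rw [hδw, hmx, Matrix.map_mul, Matrix.map_mul, Matrix.coe_units_inv, map_nonsing_inv_of_isUnit evw _ (Matrix.isUnits_det_units x), hPi, hPv]
  -- `φ_θ(ι_w) = Y₀`: both sides are `c_w` times a cofactor (★ P3 `hermitianMoebius_one_add_smul_eq`)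
  have hNu : IsUnit ((1 : Matrix (Fin 3) (Fin 3) (w.1.adicCompletion L)) + (cw - θ'w) • W).det := by
    obtain ⟨d, -, hd⟩ := hm; rw [one_smul] at hd; exact IsUnit.of_mul_eq_one_right d hd
  have hDι : IsUnit ((cw - θ'w) • ιw + θ'w • (1 : Matrix (Fin 3) (Fin 3) (w.1.adicCompletion L))).det := by
    rw [hιW, smul_one_add_smul_add_smul_one_of_add_eq W cw (cw - θ'w) θ'w (by ring), Matrix.det_smul]
    exact (IsUnit.pow _ (isUnit_iff_ne_zero.2 hc0)).mul hNu
  have hφι : (θw • ιw + (cw - θw) • (1 : Matrix (Fin 3) (Fin 3) (w.1.adicCompletion L))) * ((cw - θ'w) • ιw + θ'w • (1 : Matrix (Fin 3) (Fin 3) (w.1.adicCompletion L)))⁻¹ = Y₀ := by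
    rw [hιW, hY₀, one_smul]; exact hermitianMoebius_one_add_smul_eq W hc0 θw θ'w hNu
  -- the `E_v`-level denominator of `δ` is a unit (one place above `v`; its `w`-component is `det P · (c_w³ det N₋) · det P⁻¹`)
  have hDδ : IsUnit ((c - θ') • ((δ.val : GL (Fin 3) (LocalRing L v)).val : Matrix (Fin 3) (Fin 3) (LocalRing L v)) + θ' • (1 : Matrix (Fin 3) (Fin 3) (LocalRing L v))).det := by
    refine isUnit_localRing_of_ne_zero_of_subsingleton L v hv fun h0 => ?_
    have hw0 := congrFun h0 w
    have e1 : (((c - θ') • ((δ.val : GL (Fin 3) (LocalRing L v)).val : Matrix (Fin 3) (Fin 3) (LocalRing L v)) + θ' • (1 : Matrix (Fin 3) (Fin 3) (LocalRing L v))).det) w =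
        ((cw - θ'w) • δw + θ'w • (1 : Matrix (Fin 3) (Fin 3) (w.1.adicCompletion L))).det := by
      have e0 : (((c - θ') • ((δ.val : GL (Fin 3) (LocalRing L v)).val : Matrix (Fin 3) (Fin 3) (LocalRing L v)) + θ' • (1 : Matrix (Fin 3) (Fin 3) (LocalRing L v))).det) w =
          evw (((c - θ') • ((δ.val : GL (Fin 3) (LocalRing L v)).val : Matrix (Fin 3) (Fin 3) (LocalRing L v)) + θ' • (1 : Matrix (Fin 3) (Fin 3) (LocalRing L v))).det) := rfl
      rw [e0, RingHom.map_det, RingHom.mapMatrix_apply, map_smul_add_smul_one]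
      rfl
    rw [e1, Pi.zero_apply, hδconj, smul_units_conj_add_smul_one P ιw (cw - θ'w) θ'w, Matrix.det_units_conj] at hw0
    exact hDι.ne_zero hw0
  -- `φ_θ(δ)_w = P·Y₀·P⁻¹` (★ p853671 `map_genMoebius`, ★ P1 `moebius_conj'`) and `X_δ = P(1 + W)P⁻¹`
  have hYw : ((δ'.val : GL (Fin 3) (LocalRing L v)).val.map evw) = (P : Matrix (Fin 3) (Fin 3) (w.1.adicCompletion L)) * Y₀ * ((P⁻¹ : GL (Fin 3) (w.1.adicCompletion L)) : Matrix (Fin 3) (Fin 3) (w.1.adicCompletion L)) := by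
    rw [hδ, map_genMoebius evw _ _ _ _ _ hDδ, map_sub, map_sub]
    change (θw • δw + (cw - θw) • (1 : Matrix (Fin 3) (Fin 3) (w.1.adicCompletion L))) * ((cw - θ'w) • δw + θ'w • 1)⁻¹ = _
    rw [hδconj, Matrix.coe_units_inv, moebius_conj' _ _ (Matrix.isUnits_det_units P) _ _ _ _ hDι, hφι]
  have hXw : 1 + cw⁻¹ • (δw - 1) = (P : Matrix (Fin 3) (Fin 3) (w.1.adicCompletion L)) * (1 + W) * ((P⁻¹ : GL (Fin 3) (w.1.adicCompletion L)) : Matrix (Fin 3) (Fin 3) (w.1.adicCompletion L)) := by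
    have h1 := smul_units_conj_add_smul_one P ιw cw⁻¹ (1 - cw⁻¹)
    have e2 : cw⁻¹ • ιw + (1 - cw⁻¹) • (1 : Matrix (Fin 3) (Fin 3) (w.1.adicCompletion L)) = 1 + W := by rw [hW, smul_sub, sub_smul, one_smul]; abel
    rw [e2] at h1
    rw [← h1, hδconj, smul_sub, sub_smul, one_smul]
    abel
  -- transport of the three memberships along `P`
  refine ⟨?_, ?_, ?_⟩
  · rw [hYw]
    change _ ∈ Algebra.adjoin O ({1 + cw⁻¹ • (δw - 1)} : Set (Matrix (Fin 3) (Fin 3) (w.1.adicCompletion L)))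
    rw [hXw]
    exact conj_mem_adjoin_of_mem_adjoin O P (mem_adjoin_one_add_of_mem_adjoin O hY₀mem)
  · rw [hYw, units_conj_nonsing_inv P Y₀ (by
      rw [hY₀, Matrix.det_mul]
      exact (by obtain ⟨d, -, hd⟩ := hp; exact IsUnit.of_mul_eq_one_right d hd : IsUnit _).mul (Matrix.isUnit_nonsing_inv_det _ (by rw [one_smul]; exact hNu)))]
    change _ ∈ Algebra.adjoin O ({1 + cw⁻¹ • (δw - 1)} : Set (Matrix (Fin 3) (Fin 3) (w.1.adicCompletion L)))
    rw [hXw]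
    exact conj_mem_adjoin_of_mem_adjoin O P (mem_adjoin_one_add_of_mem_adjoin O hY₀inv)
  · change 1 + cw⁻¹ • (δw - 1) ∈ Algebra.adjoin O ({((δ'.val : GL (Fin 3) (LocalRing L v)).val.map evw)} : Set (Matrix (Fin 3) (Fin 3) (w.1.adicCompletion L)))
    rw [hXw, hYw]
    exact conj_mem_adjoin_of_mem_adjoin O P (one_add_mem_adjoin_of_mem O hWmem)

end Literature.NumberTheory.Rogawski1990

end
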